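import Mathlib
import Summits.Ventures.PercRepro2.HCov
import Summits.Ventures.PercRepro2.RootLeafUSigns
import Summits.Ventures.PercRepro2.RootLeafUSignsBC
import Summits.Ventures.PercRepro2.RootLeafUSecond
import Summits.Ventures.PercRepro2.RootLeafUHalf
import Summits.Ventures.PercRepro2.RootLeafUOu
import Summits.Ventures.PercRepro2.RootLeafUMixK
import Summits.Ventures.PercRepro2.RootLeafUMixL

/-!
# W1 on the diagonal `b = c`: `0 ≤ T2 p ends o a₂ c c u` (blind cell PercRepro2, p4 g16; S3 (G4-u)
item (ac-2), the corner `B(0,0,3)` of the 3-coin class «`b` adjacent to `a₂, u, c`»; no definitions)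

With the mark `b` placed at `c` the second root-leaf coefficient collapses onto four kernel facts
(`T2_diag_eq`, a mass identity):

  `T2(b = c) = 2(D + 2t)·(e0·t′ − d0·P(T′, oK)) + 2(1 + h_c)·ℋ′ + 2(D + 2t′)·(h_c·P(PD, oL) − d0·P(T, oL)) + 2d0·δ_o`

(`D, t, t′` the masses of `PD, T, T′`; `d0 = P(c ∉ K)`, `e0 = P(c ∉ K, o ∈ K)`, `h_c = P(a₂ ↔ c)`;
`ℋ′ = t′·P(PD, oK) − D·P(T′, oK)`, `δ_o = t·P(PD, oL) − D·P(T, oL)`), and every bracket is `≥ 0`: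
the first is `I2_nonneg` with `b := c`, the second `MixK.HoK_nonneg` (BHK06 1.4), the third `B_nonneg`
with `b := c` (explore `C(u)`: on `{o ∈ L, c ∉ L, u ↮ a₂}` the residual probability of `a₂ ↔ c` is at
most `h_c`), the fourth `ToL_mul_D_le` (BHK06 1.4).  Hence **`T2_nonneg_diag`**.  It is the
`q²(1−q)`-coefficient of S3.8's `Gc_diag3_eq = 2(D + 2t)·M₂ + 2(D + 2t′)·M₁` for a root pendant at
`u`, and the first of the 36 Bernstein targets of proofs/P4-G16-COIN3.md.
-/

namespace Summit.Ventures.PercRepro2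

open UnionCluster CovForm

namespace RootLeafU

namespace Diag

variable {V : Type*} {E : Type*} [Fintype E] [DecidableEq E] [Fintype V] [DecidableEq V]
  {R : Type*} [Field R] [LinearOrder R] [IsStrictOrderedRing R]

section Events

variable (ends : E → Sym2 V) (o a₂ c u : V)

omit [Fintype E] [DecidableEq E] [Fintype V] [DecidableEq V] in
/-- `PD ∩ {c ∈ K} = ∅`. -/
lemma PD_inter_cK : PDEvent ends u a₂ c ∩ connEvent ends a₂ c = ∅ := by
  ext ω
  simp only [PDEvent, Dtilde, UnionCluster.inU, Set.mem_inter_iff, Set.mem_compl_iff, Set.mem_union,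
    mem_connEvent, Set.mem_empty_iff_false, iff_false, not_and]
  intro h hc
  exact h.2 (Or.inr (conn_symm hc))

omit [Fintype E] [DecidableEq E] [Fintype V] [DecidableEq V] in
/-- `PD ∩ {c ∈ L} = ∅`. -/
lemma PD_inter_cL : PDEvent ends u a₂ c ∩ connEvent ends u c = ∅ := by
  ext ω
  simp only [PDEvent, Dtilde, UnionCluster.inU, Set.mem_inter_iff, Set.mem_compl_iff, Set.mem_union,
    mem_connEvent, Set.mem_empty_iff_false, iff_false, not_and]
  intro h hc
  exact h.2 (Or.inl (conn_symm hc))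

omit [Fintype E] [DecidableEq E] [Fintype V] [DecidableEq V] in
/-- `T ∩ {c ∈ K} = T`. -/
lemma T_inter_cK : TEvent ends u a₂ c ∩ connEvent ends a₂ c = TEvent ends u a₂ c := by
  ext ω
  simp only [TEvent, Set.mem_inter_iff, Set.mem_compl_iff, mem_connEvent]
  exact ⟨fun h => h.1, fun h => ⟨h, h.2⟩⟩

omit [Fintype E] [DecidableEq E] [Fintype V] [DecidableEq V] in
/-- `T ∩ {c ∈ L} = ∅` (`c ∈ K ∩ L` would join `u` to `a₂`). -/
lemma T_inter_cL : TEvent ends u a₂ c ∩ connEvent ends u c = ∅ := by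
  ext ω
  simp only [TEvent, Set.mem_inter_iff, Set.mem_compl_iff, mem_connEvent, Set.mem_empty_iff_false,
    iff_false, not_and]
  intro h hc
  exact h.1 (conn_trans h.2 (conn_symm hc))

omit [Fintype E] [DecidableEq E] [Fintype V] [DecidableEq V] in
/-- `T′ ∩ {c ∈ K} = ∅`. -/
lemma Tp_inter_cK : TEvent ends a₂ u c ∩ connEvent ends a₂ c = ∅ := by
  ext ω
  simp only [TEvent, Set.mem_inter_iff, Set.mem_compl_iff, mem_connEvent, Set.mem_empty_iff_false,
    iff_false, not_and]
  intro h hc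
  exact h.1 (conn_trans h.2 (conn_symm hc))

omit [Fintype E] [DecidableEq E] [Fintype V] [DecidableEq V] in
/-- `T′ ∩ {c ∈ L} = T′`. -/
lemma Tp_inter_cL : TEvent ends a₂ u c ∩ connEvent ends u c = TEvent ends a₂ u c := by
  ext ω
  simp only [TEvent, Set.mem_inter_iff, Set.mem_compl_iff, mem_connEvent]
  exact ⟨fun h => h.1, fun h => ⟨h, h.2⟩⟩

omit [Fintype E] [DecidableEq E] [Fintype V] [DecidableEq V] in
/-- `T ∩ (oL ∩ cL) = ∅`. -/
lemma T_inter_oL_cL : TEvent ends u a₂ c ∩ (connEvent ends u o ∩ connEvent ends u c) = ∅ := by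
  rw [← Set.inter_assoc, Set.inter_right_comm, T_inter_cL, Set.empty_inter]

omit [Fintype E] [DecidableEq E] [Fintype V] [DecidableEq V] in
/-- `PD ∩ (oL ∩ cK) = ∅`. -/
lemma PD_inter_oL_cK : PDEvent ends u a₂ c ∩ (connEvent ends u o ∩ connEvent ends a₂ c) = ∅ := by
  rw [← Set.inter_assoc, Set.inter_right_comm, PD_inter_cK, Set.empty_inter]

omit [Fintype E] [DecidableEq E] [Fintype V] [DecidableEq V] in
/-- `T ∩ (oL ∩ cK) = T ∩ oL`. -/
lemma T_inter_oL_cK :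
    TEvent ends u a₂ c ∩ (connEvent ends u o ∩ connEvent ends a₂ c) = TEvent ends u a₂ c ∩ connEvent ends u o := by
  rw [← Set.inter_assoc, Set.inter_right_comm, T_inter_cK]

omit [Fintype E] [DecidableEq E] [Fintype V] [DecidableEq V] in
/-- `T′ ∩ (oK ∩ cK) = ∅`. -/
lemma Tp_inter_oK_cK : TEvent ends a₂ u c ∩ (connEvent ends a₂ o ∩ connEvent ends a₂ c) = ∅ := by
  rw [← Set.inter_assoc, Set.inter_right_comm, Tp_inter_cK, Set.empty_inter]

omit [Fintype E] [DecidableEq E] [Fintype V] [DecidableEq V] in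
/-- `PD ∩ (oK ∩ cL) = ∅`. -/
lemma PD_inter_oK_cL : PDEvent ends u a₂ c ∩ (connEvent ends a₂ o ∩ connEvent ends u c) = ∅ := by
  rw [← Set.inter_assoc, Set.inter_right_comm, PD_inter_cL, Set.empty_inter]

omit [Fintype E] [DecidableEq E] [Fintype V] [DecidableEq V] in
/-- `T′ ∩ (oK ∩ cL) = T′ ∩ oK`. -/
lemma Tp_inter_oK_cL :
    TEvent ends a₂ u c ∩ (connEvent ends a₂ o ∩ connEvent ends u c) = TEvent ends a₂ u c ∩ connEvent ends a₂ o := by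
  rw [← Set.inter_assoc, Set.inter_right_comm, Tp_inter_cL]

omit [Fintype E] [DecidableEq E] [Fintype V] in
/-- The (I2) event with `b := c`: `{o ∈ K, c ∈ L, K avoids {c, u}} = T′ ∩ oK`. -/
lemma I2_event_eq :
    connEvent ends a₂ o ∩ connEvent ends u c ∩ avoidAll ends a₂ {c, u} =
      TEvent ends a₂ u c ∩ connEvent ends a₂ o := by
  ext ω
  simp only [TEvent, avoidAll, Set.mem_inter_iff, Set.mem_compl_iff, mem_connEvent, Set.mem_setOf_eq,
    Finset.mem_insert, Finset.mem_singleton, forall_eq_or_imp, forall_eq]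
  constructor
  · rintro ⟨⟨ho, hc⟩, _, hau⟩
    exact ⟨⟨fun h => hau (conn_symm h), hc⟩, ho⟩
  · rintro ⟨⟨hu, hc⟩, ho⟩
    exact ⟨⟨ho, hc⟩, fun h => hu (conn_trans hc (conn_symm h)), fun h => hu (conn_symm h)⟩

omit [Fintype E] [DecidableEq E] [Fintype V] in
/-- The (I2) base event with `b := c`: `{c ∈ L, K avoids {c, u}} = T′`. -/
lemma I2_base_eq : connEvent ends u c ∩ avoidAll ends a₂ {c, u} = TEvent ends a₂ u c := by
  ext ω
  simp only [TEvent, avoidAll, Set.mem_inter_iff, Set.mem_compl_iff, mem_connEvent, Set.mem_setOf_eq,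
    Finset.mem_insert, Finset.mem_singleton, forall_eq_or_imp, forall_eq]
  constructor
  · rintro ⟨hc, _, hau⟩
    exact ⟨fun h => hau (conn_symm h), hc⟩
  · rintro ⟨hu, hc⟩
    exact ⟨hc, fun h => hu (conn_trans hc (conn_symm h)), fun h => hu (conn_symm h)⟩

omit [Fintype E] [DecidableEq E] [Fintype V] [DecidableEq V] in
/-- The (B) event with `b := c`: `{o ∈ L, c ∉ L, c ∈ K, u ↮ a₂} = T ∩ oL`. -/
lemma B_event_eq :
    connEvent ends u o ∩ (connEvent ends u c)ᶜ ∩ connEvent ends a₂ c ∩ (connEvent ends u a₂)ᶜ =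
      TEvent ends u a₂ c ∩ connEvent ends u o := by
  ext ω
  simp only [TEvent, Set.mem_inter_iff, Set.mem_compl_iff, mem_connEvent]
  constructor
  · rintro ⟨⟨⟨ho, _⟩, hc⟩, hu⟩
    exact ⟨⟨fun h => hu (conn_symm h), hc⟩, ho⟩
  · rintro ⟨⟨hu, hc⟩, ho⟩
    exact ⟨⟨⟨ho, fun h => hu (conn_trans hc (conn_symm h))⟩, hc⟩, fun h => hu (conn_symm h)⟩

omit [Fintype E] [DecidableEq E] [Fintype V] [DecidableEq V] in
/-- The (B) base event: `{o ∈ L, c ∉ L, u ↮ a₂} = (PD ∩ oL) ∪ (T ∩ oL)`. -/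
lemma B_base_eq :
    connEvent ends u o ∩ (connEvent ends u c)ᶜ ∩ (connEvent ends u a₂)ᶜ =
      (PDEvent ends u a₂ c ∩ connEvent ends u o) ∪ (TEvent ends u a₂ c ∩ connEvent ends u o) := by
  ext ω
  simp only [PDEvent, TEvent, Dtilde, UnionCluster.inU, Set.mem_inter_iff, Set.mem_compl_iff,
    Set.mem_union, mem_connEvent]
  constructor
  · rintro ⟨⟨ho, hcL⟩, hu⟩
    by_cases hcK : Conn ends ω a₂ c
    · exact Or.inr ⟨⟨fun h => hu (conn_symm h), hcK⟩, ho⟩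
    · exact Or.inl ⟨⟨hu, fun h => h.elim (fun h' => hcL (conn_symm h')) (fun h' => hcK (conn_symm h'))⟩, ho⟩
  · rintro (⟨⟨hu, hD⟩, ho⟩ | ⟨⟨hu, hcK⟩, ho⟩)
    · exact ⟨⟨ho, fun h => hD (Or.inl (conn_symm h))⟩, hu⟩
    · exact ⟨⟨ho, fun h => hu (conn_trans hcK (conn_symm h))⟩, fun h => hu (conn_symm h)⟩

omit [Fintype E] [DecidableEq E] [Fintype V] [DecidableEq V] in
/-- `PD ∩ oL` and `T ∩ oL` are disjoint. -/
lemma disjoint_PD_T_oL :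
    Disjoint (PDEvent ends u a₂ c ∩ connEvent ends u o) (TEvent ends u a₂ c ∩ connEvent ends u o) := by
  rw [Set.disjoint_left]
  rintro ω ⟨⟨_, hD⟩, _⟩ ⟨⟨_, hcK⟩, _⟩
  simp only [Dtilde, UnionCluster.inU, Set.mem_compl_iff, Set.mem_union, mem_connEvent] at hD
  exact hD (Or.inr (conn_symm hcK))

end Events

section Theorem

variable (p : E → R) (ends : E → Sym2 V) (o a₂ c u : V)

/-- **The diagonal identity**: `T2(b = c)` as four brackets. -/
theorem T2_diag_eq :
    T2 p ends o a₂ c c u =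
      2 * (prob p (PDEvent ends u a₂ c) + 2 * prob p (TEvent ends u a₂ c)) *
          (prob p (avoidAll ends a₂ {c} ∩ connEvent ends a₂ o) * prob p (TEvent ends a₂ u c) -
            prob p (avoidAll ends a₂ {c}) * prob p (TEvent ends a₂ u c ∩ connEvent ends a₂ o)) +
        2 * (1 + prob p (connEvent ends a₂ c)) *
          (prob p (TEvent ends a₂ u c) * prob p (PDEvent ends u a₂ c ∩ connEvent ends a₂ o) -
            prob p (PDEvent ends u a₂ c) * prob p (TEvent ends a₂ u c ∩ connEvent ends a₂ o)) +
        2 * (prob p (PDEvent ends u a₂ c) + 2 * prob p (TEvent ends a₂ u c)) *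
          (prob p (connEvent ends a₂ c) * prob p (PDEvent ends u a₂ c ∩ connEvent ends u o) -
            prob p (avoidAll ends a₂ {c}) * prob p (TEvent ends u a₂ c ∩ connEvent ends u o)) +
        2 * prob p (avoidAll ends a₂ {c}) *
          (prob p (TEvent ends u a₂ c) * prob p (PDEvent ends u a₂ c ∩ connEvent ends u o) -
            prob p (PDEvent ends u a₂ c) * prob p (TEvent ends u a₂ c ∩ connEvent ends u o)) := by
  have hd : prob p (avoidAll ends a₂ {c}) = 1 - prob p (connEvent ends a₂ c) := by
    rw [avoidAll_singleton_eq, prob_compl]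
  rw [T2_eq_T2oL_add_T2oK]
  unfold T2oL T2oK Ee EQb3 PDb EQ3
  rw [gap_eq_Q p ends u a₂ c, Qsplit p ends u a₂ c (connEvent ends a₂ c),
    Qsplit p ends u a₂ c (connEvent ends u c), Qsplit_univ p ends u a₂ c, prob_univ,
    PD_inter_cK, PD_inter_cL, T_inter_cK, T_inter_cL, Tp_inter_cK, Tp_inter_cL,
    T_inter_oL_cL, PD_inter_oL_cK, T_inter_oL_cK, Tp_inter_oK_cK, PD_inter_oK_cL, Tp_inter_oK_cL,
    prob_empty, hd]
  ring

/-- **W1 on the diagonal `b = c`**: `0 ≤ T2 p ends o a₂ c c u`. -/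
theorem T2_nonneg_diag (hp : IsProbVec p) : 0 ≤ T2 p ends o a₂ c c u := by
  rw [T2_diag_eq]
  -- (i) `I2_nonneg` with `b := c`
  have h1 : 0 ≤ prob p (avoidAll ends a₂ {c} ∩ connEvent ends a₂ o) * prob p (TEvent ends a₂ u c) -
      prob p (avoidAll ends a₂ {c}) * prob p (TEvent ends a₂ u c ∩ connEvent ends a₂ o) := by
    have h := I2_nonneg p ends o a₂ c c u hp
    rw [I2_event_eq, I2_base_eq, ← avoidAll_singleton_eq, Set.inter_comm (connEvent ends a₂ o)] at h
    linarith
  -- (ii) `ℋ′ ≥ 0`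
  have h2 := MixK.HoK_nonneg p ends o a₂ c u hp
  -- (iii) `B_nonneg` with `b := c`
  have h3 : 0 ≤ prob p (connEvent ends a₂ c) * prob p (PDEvent ends u a₂ c ∩ connEvent ends u o) -
      prob p (avoidAll ends a₂ {c}) * prob p (TEvent ends u a₂ c ∩ connEvent ends u o) := by
    have h := B_nonneg p ends o a₂ c c u hp
    rw [B_event_eq, B_base_eq, prob_union_of_disjoint p (disjoint_PD_T_oL ends o a₂ c u)] at h
    have hd : prob p (avoidAll ends a₂ {c}) = 1 - prob p (connEvent ends a₂ c) := by
      rw [avoidAll_singleton_eq, prob_compl]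
    rw [hd]
    nlinarith [h]
  -- (iv) `δ_o ≥ 0`
  have h4 := ToL_mul_D_le p hp ends o u a₂ c
  have hD := prob_nonneg hp (PDEvent ends u a₂ c)
  have ht := prob_nonneg hp (TEvent ends u a₂ c)
  have htp := prob_nonneg hp (TEvent ends a₂ u c)
  have hc := prob_nonneg hp (connEvent ends a₂ c)
  have hd0 := prob_nonneg hp (avoidAll ends a₂ {c})
  have e1 : 0 ≤ prob p (PDEvent ends u a₂ c) + 2 * prob p (TEvent ends u a₂ c) := by linarith
  have e2 : 0 ≤ 1 + prob p (connEvent ends a₂ c) := by linarith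
  have e3 : 0 ≤ prob p (PDEvent ends u a₂ c) + 2 * prob p (TEvent ends a₂ u c) := by linarith
  have h4' : 0 ≤ prob p (TEvent ends u a₂ c) * prob p (PDEvent ends u a₂ c ∩ connEvent ends u o) -
      prob p (PDEvent ends u a₂ c) * prob p (TEvent ends u a₂ c ∩ connEvent ends u o) := by linarith
  have := mul_nonneg (mul_nonneg zero_le_two e1) h1
  have := mul_nonneg (mul_nonneg zero_le_two e2) h2
  have := mul_nonneg (mul_nonneg zero_le_two e3) h3
  have := mul_nonneg (mul_nonneg zero_le_two hd0) h4'
  linarith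

end Theorem

end Diag

end RootLeafU

end Summit.Ventures.PercRepro2
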